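import Mathlib
import Summits.Ventures.HodgeRepro2.T5HermitianIsotropicLattice

/-!
# Non-vacuity of the integral normal form: the `p`-adic orthogonal witness

Blind cell `pub-hodge-repro2`, seat p8 (gen 13), Tier-5 kernel support.  The hypotheses of
`T5HermitianIsotropicLattice.exists_congruent_J3_integral_of_isotropic` are jointly satisfiable:
over `R = ℤ_p ⊂ E = ℚ_p` with the TRIVIAL involution (`starRingOfComm`, the orthogonal case of the
package as in `T5UnitaryThreeHecke.isCartanDecomposition_three_padic`) and `p ≠ 2`, the unimodular
form `diag(1, 1, -1)` is isotropic (`(1, 0, 1)`), so `diag(1, 1, -1) ≅ antidiag(1, u, 1)` over `ℤ_p`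
with `u ∈ ℤ_p^×` — `toy_padic_exists_congruent_J3_integral`.  (The witness is for the SHAPE of the
hypotheses; the record's inert places carry a non-trivial involution.)

README §8(d): uses an L-value-free non-vanishing device: NO.
-/

namespace Summit.Ventures.HodgeRepro2.T5IsotropicLatticeToy

open IsLocalization Matrix T5UnitaryGroupIsometry T5IntegralUnits T5HermitianIsotropicLattice

variable (p : ℕ) [Fact p.Prime]

/-- `2` is a unit of `ℤ_p` for `p ≠ 2`. -/
theorem isUnit_two (hp : p ≠ 2) : IsUnit (2 : ℤ_[p]) := by
  rw [PadicInt.isUnit_iff, show (2 : ℤ_[p]) = ((2 : ℕ) : ℤ_[p]) from by norm_cast,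
    PadicInt.norm_natCast_eq_one_iff]
  exact (Nat.Prime.coprime_iff_not_dvd (Fact.out)).mpr fun h =>
    hp ((Nat.prime_dvd_prime_iff_eq (Fact.out) Nat.prime_two).mp h)

/-- `2⁻¹ ∈ ℤ_p` for `p ≠ 2`. -/
theorem isInteger_two_inv (hp : p ≠ 2) : IsInteger ℤ_[p] (2 : ℚ_[p])⁻¹ := by
  have := T5UnitaryThreeCorner.isInteger_inv_of_isUnit (E := ℚ_[p]) (isUnit_two p hp)
  rwa [map_ofNat] at this

/-- The toy form `diag(1, 1, -1)` over `ℚ_p`. -/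
noncomputable def toyH : Matrix (Fin 3) (Fin 3) ℚ_[p] := Matrix.diagonal ![1, 1, -1]

/-- `diag(1, 1, -1)` squares to `1`. -/
theorem toyH_mul_toyH : toyH p * toyH p = 1 := by
  rw [toyH, Matrix.diagonal_mul_diagonal]
  ext i j
  fin_cases i <;> fin_cases j <;> simp

/-- **The `p`-adic witness**: for `p ≠ 2`, `diag(1, 1, -1)` over `ℤ_p` with the trivial involution
is congruent over `ℤ_p` to `antidiag(1, u, 1)` with `u ∈ ℤ_p^×`. -/
theorem toy_padic_exists_congruent_J3_integral (hp : p ≠ 2) :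
    letI : StarRing ℚ_[p] := starRingOfComm
    ∃ P : Matrix (Fin 3) (Fin 3) ℚ_[p], (∀ i j, IsInteger ℤ_[p] (P i j)) ∧ IsRUnit ℤ_[p] P.det ∧
      ∃ u : ℚ_[p], IsRUnit ℤ_[p] u ∧ star u = u ∧
        Pᴴ * toyH p * P = T5HermitianThreeElements.J3 u := by
  letI : StarRing ℚ_[p] := starRingOfComm
  have hstar : ∀ x : ℚ_[p], IsInteger ℤ_[p] x → IsInteger ℤ_[p] (star x) := fun x hx => hx
  have hH : (toyH p).IsHermitian := by
    rw [toyH, Matrix.isHermitian_diagonal_iff]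
    intro i
    exact rfl
  have hHint : ∀ i j, IsInteger ℤ_[p] (toyH p i j) := by
    intro i j
    rw [toyH, Matrix.diagonal_apply]
    split_ifs
    · fin_cases i
      · exact isInteger_one
      · exact isInteger_one
      · exact T5UnitaryThreeCorner.isInteger_neg isInteger_one
    · exact isInteger_zero
  have hHdet : IsUnit (toyH p).det := by
    rw [toyH, Matrix.det_diagonal, Fin.prod_univ_three]
    simp
  have hHinv : ∀ i j, IsInteger ℤ_[p] ((toyH p)⁻¹ i j) := by
    rw [Matrix.inv_eq_right_inv (toyH_mul_toyH p)]
    exact hHint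
  have hv : (![1, 0, 1] : Fin 3 → ℚ_[p]) ≠ 0 := by
    intro h
    have := congrFun h 0
    simp at this
  have hv0 : sesqForm (toyH p) ![1, 0, 1] ![1, 0, 1] = 0 := by
    simp [sesqForm, toyH, Matrix.mulVec_diagonal, dotProduct, Fin.sum_univ_three]
  exact exists_congruent_J3_integral_of_isotropic hstar (isInteger_two_inv p hp) two_ne_zero hH
    hHint hHdet hHinv hv hv0

end Summit.Ventures.HodgeRepro2.T5IsotropicLatticeToy
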